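import Summits.QuantumAdvantage.AdviceFreeQNC0.OddPrimeStatements
import HarnessLib

/-!
# Cell qa-qnc0 (rung F-Q2-odd, ROUND-13 §1/§4): the charge pair, the AVOIDANCE NORMAL FORM of the u-game, `TwoSpeedLoses`

Planner qa-qnc0-p2 g13, `ROUND-13.md` §6 ask (1) / `line13/Sketch13p2.lean` §1 and §4, statements VERBATIM
(`sigmaRes`, `cutRes`, `labelCount`, **`ChargePair`**, **`AvoidNormalForm`**, **`TwoSpeedLoses`**), all PROVED:

* `avoidNormalForm : AvoidNormalForm` — the DICTIONARY: `(y, u)` wins charge `c` iff among the two hidden labels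
  `a ≠ σ(u) = (c + |u|) mod 3` EXACTLY ONE carries an odd number of active cuts (the counted cuts of `ringWinU` are the
  active cuts `g` with label `a_g = 2(g + W_g(u)) ≢ σ`, since `c + g + |u| + W_g ≡ σ − a_g`; so the win parity is
  `N_{σ+1} + N_{σ+2} mod 2`).  The u-game is an oracle-free ELIMINATION game on `σ`.
* `chargePair : ChargePair` — the number of won charges among `c, c+1, c+2` is EXACTLY `0` or `2` (sharpens the tree's
  `ChargeTriple`: the three win parities are `N₁+N₂, N₀+N₂, N₀+N₁ (mod 2)`, which sum to `0`).
* `twoSpeedLoses : TwoSpeedLoses` — for all `B₁, B₂ ⊆ ℤ/3` some shift `t` makes `(B₁ − t) △ (B₂ − 2t)` not good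
  (`decide`, 64 pairs).

(`WindowLocalHardU` of §2 — junta degree + `ringWinU_localRules_le` — is not in this file.)

WHAT THIS IS NOT: identities only — no hardness statement; nothing on `WalkHardF p`; separation NOT moved.
-/

noncomputable section

namespace Summit.QuantumAdvantage.AdviceFreeQNC0

open Finset
open Literature.Computability.QuantumComplexity Literature.Computability.MetaComplexity

variable {n : ℕ}

/-! ### Statements (qa-qnc0-p2 Sketch13p2 §1, §4 — verbatim) -/

/-- `σ(u) = (c + |u|) mod 3` — the residue the hidden walk structure compares against. (Sketch13p2 §1, verbatim.) -/
def sigmaRes (c : ℕ) (u : Fin n → Bool) : ℕ := (c + wt u) % 3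

/-- The hidden label of cut `g`: `a_g(u) = −(g + W_g(u)) mod 3 = 2·(g + W_g(u)) mod 3`, so that
`(c + g + walkExp u g) % 3 = (σ − a_g) % 3`. (Sketch13p2 §1, verbatim.) -/
def cutRes (u : Fin n → Bool) (g : ℕ) : ℕ := (2 * (g + wtPrefix u g)) % 3

/-- `N_a(u)`: number of ACTIVE cuts (`y g u = true`) whose hidden label is `a`. (Sketch13p2 §1, verbatim.) -/
def labelCount (y : Fin (n + 1) → (Fin n → Bool) → Bool) (u : Fin n → Bool) (a : ℕ) : ℕ :=
  (univ.filter fun g : Fin (n + 1) => y g u = true ∧ cutRes u g.val = a).card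

/-- **`ChargePair`** (Sketch13p2 §1, verbatim; sharpens the tree's `ChargeTriple`): for every output vector and pattern
the number of won charges among `c, c+1, c+2` is EXACTLY `0` or `2`. -/
def ChargePair : Prop :=
  ∀ (n c : ℕ) (y : Fin (n + 1) → (Fin n → Bool) → Bool) (u : Fin n → Bool),
    (univ.filter fun ρ : Fin 3 => ringWinU (c + ρ.val) y u = true).card = 0 ∨
    (univ.filter fun ρ : Fin 3 => ringWinU (c + ρ.val) y u = true).card = 2

/-- **`AvoidNormalForm`** (Sketch13p2 §1, verbatim; the dictionary): `(y, u)` wins charge `c` iff among the two labels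
`a ≠ σ(u)` EXACTLY ONE has an odd number of active cuts. -/
def AvoidNormalForm : Prop :=
  ∀ (n c : ℕ) (y : Fin (n + 1) → (Fin n → Bool) → Bool) (u : Fin n → Bool),
    ringWinU c y u = true ↔
      (univ.filter fun a : Fin 3 => a.val ≠ sigmaRes c u ∧ labelCount y u a.val % 2 = 1).card = 1

/-- **`TwoSpeedLoses`** (Sketch13p2 §4, verbatim; finite, `decide`): for all `B₁ B₂ ⊆ ℤ/3` some `t ∈ ℤ/3` makes
`(B₁ − t) △ (B₂ − 2t)` NOT good (good = contains exactly one nonzero residue). -/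
def TwoSpeedLoses : Prop :=
  ∀ B₁ B₂ : Finset (Fin 3), ∃ t : Fin 3,
    (univ.filter fun a : Fin 3 =>
        a ≠ 0 ∧ ((decide (a + t ∈ B₁)) != (decide (a + 2 * t ∈ B₂))) = true).card ≠ 1

/-! ### A three-element filter is the sum of its three indicator values -/

/-- The cardinality of a filter of `Fin 3` as three indicators. -/
private theorem card_filter_fin3 (P : Fin 3 → Prop) [DecidablePred P] :
    (univ.filter P).card = (if P 0 then 1 else 0) + (if P 1 then 1 else 0) + (if P 2 then 1 else 0) := by
  rw [Finset.card_filter]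
  convert Fin.sum_univ_three (fun i : Fin 3 => if P i then 1 else 0)

/-! ### The avoidance normal form -/

/-- The counted cuts of `ringWinU` are the active cuts whose label differs from `σ`; splitting them by label,
`#counted = N_{(σ+1) mod 3} + N_{(σ+2) mod 3}`. -/
private theorem card_counted_eq (c : ℕ) (y : Fin (n + 1) → (Fin n → Bool) → Bool) (u : Fin n → Bool) :
    (univ.filter fun g : Fin (n + 1) => y g u = true ∧ (c + g.val + walkExp u g.val) % 3 ≠ 0).card =
      labelCount y u ((sigmaRes c u + 1) % 3) + labelCount y u ((sigmaRes c u + 2) % 3) := by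
  unfold labelCount
  rw [Finset.card_filter, Finset.card_filter, Finset.card_filter, ← Finset.sum_add_distrib]
  refine Finset.sum_congr rfl fun g _ => ?_
  unfold walkExp cutRes sigmaRes
  by_cases hy : y g u = true
  · simp only [hy, true_and]
    split_ifs <;> omega
  · simp [hy]

/-- **`AvoidNormalForm` — PROVED.** -/
theorem avoidNormalForm : AvoidNormalForm := by
  intro n c y u
  unfold ringWinU
  rw [decide_eq_true_iff, card_counted_eq, card_filter_fin3]
  simp only [Fin.val_zero, Fin.val_one, Fin.val_two]
  have hσ : sigmaRes c u < 3 := Nat.mod_lt _ (by norm_num)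
  rcases (show sigmaRes c u = 0 ∨ sigmaRes c u = 1 ∨ sigmaRes c u = 2 by omega) with h | h | h <;>
    simp only [h, Nat.reduceAdd, Nat.reduceMod, Nat.zero_add] <;> split_ifs <;> omega

/-! ### The charge pair -/

/-- An indicator governed by a parity is that parity. -/
private theorem ite_eq_mod_two {P : Prop} [Decidable P] {x : ℕ} (h : P ↔ x % 2 = 1) :
    (if P then 1 else 0) = x % 2 := by
  by_cases p : P
  · rw [if_pos p]; exact ((h.mp p)).symm
  · rw [if_neg p]
    have : ¬ (x % 2 = 1) := fun hx => p (h.mpr hx)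
    omega

/-- **`ChargePair` — PROVED**: the three win bits at charges `c, c+1, c+2` are the parities of `N₁+N₂`, `N₂+N₀`,
`N₀+N₁` (in the order fixed by `σ`), which sum to an even number, so exactly `0` or `2` of them are set. -/
theorem chargePair : ChargePair := by
  intro n c y u
  have key : ∀ ρ : Fin 3, ringWinU (c + ρ.val) y u = true ↔
      (labelCount y u ((c + ρ.val + wt u + 1) % 3) + labelCount y u ((c + ρ.val + wt u + 2) % 3)) % 2 = 1 := by
    intro ρ
    unfold ringWinU
    rw [decide_eq_true_iff, card_counted_eq]
    unfold sigmaRes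
    rw [show ((c + ρ.val + wt u) % 3 + 1) % 3 = (c + ρ.val + wt u + 1) % 3 by omega,
      show ((c + ρ.val + wt u) % 3 + 2) % 3 = (c + ρ.val + wt u + 2) % 3 by omega]
  rw [card_filter_fin3]
  have h0 := key 0
  have h1 := key 1
  have h2 := key 2
  simp only [Fin.val_zero, Fin.val_one, Fin.val_two, Nat.add_zero] at h0 h1 h2 ⊢
  rcases (show (c + wt u) % 3 = 0 ∨ (c + wt u) % 3 = 1 ∨ (c + wt u) % 3 = 2 by omega) with h | h | h
  · rw [show (c + wt u + 1) % 3 = 1 by omega, show (c + wt u + 2) % 3 = 2 by omega] at h0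
    rw [show (c + 1 + wt u + 1) % 3 = 2 by omega, show (c + 1 + wt u + 2) % 3 = 0 by omega] at h1
    rw [show (c + 2 + wt u + 1) % 3 = 0 by omega, show (c + 2 + wt u + 2) % 3 = 1 by omega] at h2
    rw [ite_eq_mod_two h0, ite_eq_mod_two h1, ite_eq_mod_two h2]
    omega
  · rw [show (c + wt u + 1) % 3 = 2 by omega, show (c + wt u + 2) % 3 = 0 by omega] at h0
    rw [show (c + 1 + wt u + 1) % 3 = 0 by omega, show (c + 1 + wt u + 2) % 3 = 1 by omega] at h1
    rw [show (c + 2 + wt u + 1) % 3 = 1 by omega, show (c + 2 + wt u + 2) % 3 = 2 by omega] at h2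
    rw [ite_eq_mod_two h0, ite_eq_mod_two h1, ite_eq_mod_two h2]
    omega
  · rw [show (c + wt u + 1) % 3 = 0 by omega, show (c + wt u + 2) % 3 = 1 by omega] at h0
    rw [show (c + 1 + wt u + 1) % 3 = 1 by omega, show (c + 1 + wt u + 2) % 3 = 2 by omega] at h1
    rw [show (c + 2 + wt u + 1) % 3 = 2 by omega, show (c + 2 + wt u + 2) % 3 = 0 by omega] at h2
    rw [ite_eq_mod_two h0, ite_eq_mod_two h1, ite_eq_mod_two h2]
    omega

/-! ### Two speeds lose -/

/-- **`TwoSpeedLoses` — PROVED** by enumeration (`decide`: 64 pairs, 3 shifts). -/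
theorem twoSpeedLoses : TwoSpeedLoses := by
  unfold TwoSpeedLoses
  decide

end Summit.QuantumAdvantage.AdviceFreeQNC0

end
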